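import Summits.QuantumFields.YangMills.Theorems.BalabanUVNodesK3AxV8Defs
import Summits.QuantumFields.YangMills.Theorems.BalabanUVNodesN16WitnessDialFaceCmap

/-!
# Route «BalabanUVNodes», crux K3ᴬ `SpineGivenEndpointR13SepCoPHVAx` (stmt-QuantumFields-27247), node N16 = NE3 — NODE N16's STUB-1 SHARE **BY NAME AT THE MIRROR**
# (`K3AxV8Defs`, ✓p812015) AND THE STUB-1 BILL WITH NODE N16 PAID: the registered stub-1 TEXT (`K3Skeleton13SepCoPHAxV8.stub_rates13HV`, b38fad1764a2d455 :672) from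
# (i) a β in print's window, (ii) ONE v4-guarded reading `GuardedReading 𝔯 ksel ℓ` (the N14 ∕ N15 ∕ node-U3 pins + keyed N15 liveness — other lanes' objects), (iii) the
# K4 face `KeyedRatesHolderD4V β` at the NE3-ERASED reading `eraseNE3Ax 𝔯` (= every rates-row conjunct EXCEPT node N16's: N14 ∕ N15 ∕ N17 ∕ N18 ∕ N22 + the (D4) read-out +
# the `ρ`-letter — other lanes' content), and (iv) node N16's reading-free tuned-witness sentence `WitnessDialN16Free 2 β` (module 63; inhabited from hE ∕ hN05 + the slot key)

Cell `pub-ymgap`, seat `pub-ymgap-dag-n16-e` (R134 acceleration seat (a), strategy s2 = BY-NAME KNIT at the record; HUMAN RULING D-0062; chair R424 venue), generation 31,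
module 65 (THEOREMS ONLY, 0 `def`, 0 `sorry`, standard axioms; v1.1 = v1 + the hN05-currency bill `stub1Text_of_n05UniformP_reg910Slot`, append-only).  `--kind proof --supports stmt-QuantumFields-27247 --as helper` (count-neutral; proves NO registered stub —
every theorem below has hypotheses).  `bears_on: R4∕N16 · edges N05 → N16, N07 → N16`.  Over M1 `…K3AxV8Defs` (✓p812015: the registered §1∕§1b∕§1V texts BY NAME,
Theses-free), module 63 `…N16WitnessDialFaceCmap` (✓p811120: `WitnessDialN16Free`, `repinAx`, the guard-generic face) and R12 `…N16PinnedLayer13CoPHAx` (✓p805490: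
`eraseNE3Ax`, `ratesHolderAt_rateCarriersCmap_eraseNE3_iff`).  The scratch PROBE of this seat's evidence #2 on 27247 (`ProbeV8Stub1N16Share-g31.lean` eae070427e036ca7), now
a tree theorem keyed on the mirror's names.

CONTENTS.  §1 the v8 guard does not read the NE3 layer: `guardedReading_repinAx` ∕ `guardedReading_eraseNE3Ax` (`h ↦ h`).  §2 ★ `exists_guardedReadingN16_of_witnessFree` —
from `WitnessDialN16Free 2 β` and ANY v4-guarded reading `𝔯`: a reading `𝔯'` with the FULL registered pin `GuardedReadingN16 𝔯' ksel ℓ ℓ₃ g B`, node N16's conjunct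
`N16HolderAt (rrOfRecord 𝔯' ksel F θ hP g₀ os).ne3 β` at every tuple, and `eraseNE3Ax 𝔯' = eraseNE3Ax 𝔯` (off the NE3 layer `𝔯'` IS `𝔯`).  §3 the K4 face splits along
node N16: `keyedRatesHolderD4V_eraseNE3` (the face at `𝔯` gives the face at the erased reading — so hypothesis (iii) is NECESSARY) and `keyedRatesHolderD4V_of_eraseNE3`
(the erased face + node N16's rows at every tuple give the face at `𝔯`; `ForSmallCouplings.mono` + R12's erased-rates `Iff`).  §4 ★★ THE BILL `stub1Text_of_witnessFree` —
(i)–(iv) ⟹ the stub-1 TEXT (spelled; = `K3AxV8StubTexts.Stub1TextV8` by `Iff.rfl`) — and its end-to-end forms from hE ∕ hN05 + the slot key.  After this file the stub-1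
text's NODE-N16 content reads: `WitnessDialN16Free 2 β` — nothing else of N16.

HONEST FRAMING.  Composition BY NAME; no estimate.  (ii) and (iii) are the OTHER lanes' objects and content, (iv)'s producers display hE ∕ hN05 (node N05's
[Balaban1985RegularSpaces] Thm 4 ∕ Prop 3 bodies — N05∕N06 content) and node N07's slot key ([Balaban1985Variational] Thm 1 (9)–(10)); ALL are HYPOTHESES asserted for no
family; NO stub of K3ᴬ v8 is closed or claimed; N16 ∕ N05 ∕ N06 ∕ N07 NOT discharged; counts UNMOVED (typed 28∕28 · discharged 8∕27 · A 8∕28).  One finite four-torus at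
fixed `ε`, Bałaban AS PRINTED — NOT ℝ⁴, NOT infinite volume, NOT OS, NOT a mass gap; the YM mass gap (Clay) is NOT proved by any of this.
References: [Balaban1985RegularSpaces] T. Bałaban, CMP **99** (1985) 75–102, Thm 4 p. 88, Prop. 3 p. 87; [Balaban1985Variational] T. Bałaban, CMP **102** (1985) 277–309, Thm 1 p. 279.
-/

set_option autoImplicit false

open scoped BigOperators Matrix Matrix.Norms.L2Operator
open NormedSpace

namespace Summit.QuantumFields.YangMills.BalabanUVNodes.N16Stub1ShareK3AxV8

open Literature.MathematicalPhysics.QuantumFieldTheory.Balaban1983to89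
open Literature.MathematicalPhysics.QuantumFieldTheory.Balaban1983to89.T4Continuum (T4Family ULoop)
open T4ContinuumYM4Torus (ForSmallCouplings)
open B7Prop1Explicit B7Prop2Explicit MatrixLog UnitaryModel
open T4AveragingDeficitWall hiding Site Plane Plaq Bond
open B7Eq92Concrete (mgauge)
open B8Ineq132 (covDerivFwd)
open B8Eq184Proof (cfgExp)
open B8Eq119TwistedAxial (Restr129)
open B8Eq138LandauZd (covLap IsLandau138)
open B8Thm4TorusAt (torusLam Thm4TorusAt)
open B8LeafModelZdHP2Per (zdGF3HP₂Per)
open Node00 (Stage13Params Stage13HParams IdxB8SubDPerκ NE3Letters₁₁ ne3NperOfRecord₁₁ MatA)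
open Summit.QuantumFields.BalabanUV.T4Continuum
open MinimalActionSandwich (IsMinimiser)
open MinimalActionRate (sfClass)
open MinimalActionDictionary (torusVP RadiiMono)
open AveragingDeficitLatticeH2Prep (fd)
open B11 (Regularity)
open YMDAG.UVSplit (Datum RateCarriers rateCarriersOfRecord₁₃CoPHCmap)
open Summit.QuantumFields.YangMills.BalabanUVNodes.N16HolderDefs (N16HolderAt)
open Summit.QuantumFields.YangMills.BalabanUVNodes.SpineRatesHolder (RatesHolderAt)
open Summit.QuantumFields.YangMills.BalabanUVNodes.N16PinnedLayer13CoPH (eraseNE3Cmap eraseNE3Ax ratesHolderAt_rateCarriersCmap_eraseNE3_iff)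
open Summit.QuantumFields.YangMills.BalabanUVNodes.N16Stage3OfFamilyMat (stage3OfFamilyMat)
open Summit.QuantumFields.YangMills.BalabanUVNodes.N16WitnessDialFaceCmap (WitnessDialN16Free repinCmap repinAx eraseNE3Cmap_repinCmap
  exists_guarded_pin_n16HolderAt_rateCarriersAx_of_witnessFree witnessDialN16Free_of_entry_reg910Slot witnessDialN16Free_of_n05UniformP_reg910Slot)
open Summit.QuantumFields.YangMills.Theorems.K3AxV8Defs (RateReading13AxP RunSel LetterReading rrOfRecord PHolderD4 KeyedRatesHolderD4V GuardedReading GuardedReadingN16)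

noncomputable section

variable {β : ℝ}

/-! ## §1 The v8 guard does not read the NE3 layer -/

/-- **THE REGISTERED v4 GUARD TRANSFERS TO THE RE-PINNED READING BY `h ↦ h`** (`GuardedReading` = N14 pin ∧ keyed N15 liveness ∧ (α-N15) pin ∧ node-U3 pin — all read
`𝔯.ne1`, `(𝔯.lit …).ne2`, `(𝔯.lit …).u3` only; kernel-checked definitional transfer). [bookkeeping] -/
theorem guardedReading_repinAx {𝔯 : RateReading13AxP} {ksel : RunSel} {ℓ : LetterReading} (h : GuardedReading 𝔯 ksel ℓ)
    (ℓ₃ : T4Family → NE3Letters₁₁) (B : T4Family → ℝ) : GuardedReading (repinAx 𝔯 ℓ₃ B) ksel ℓ := h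

/-- … and to the NE3-ERASED reading likewise. [bookkeeping] -/
theorem guardedReading_eraseNE3Ax {𝔯 : RateReading13AxP} {ksel : RunSel} {ℓ : LetterReading} (h : GuardedReading 𝔯 ksel ℓ) :
    GuardedReading (eraseNE3Ax 𝔯) ksel ℓ := h

/-! ## §2 ★ Node N16's stub-1 share, by name at the mirror -/

/-- **★ FROM THE READING-FREE WITNESS SENTENCE AND ANY v4-GUARDED READING: THE FULL REGISTERED PIN AND NODE N16's RATES-ROW CONJUNCT**, at a reading that IS `𝔯` off the
NE3 layer.  Two lines over module 63's guard-generic face at `G := fun 𝔯 => GuardedReading 𝔯 ksel ℓ`, `hG := fun _ _ _ h => h`. [bookkeeping] -/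
theorem exists_guardedReadingN16_of_witnessFree (hW : WitnessDialN16Free 2 β) {𝔯 : RateReading13AxP} {ksel : RunSel} {ℓ : LetterReading}
    (h : GuardedReading 𝔯 ksel ℓ) :
    ∃ (𝔯' : RateReading13AxP) (ℓ₃ : T4Family → NE3Letters₁₁) (g B : T4Family → ℝ), GuardedReadingN16 𝔯' ksel ℓ ℓ₃ g B ∧
      (∀ (F : T4Family) (θ : Stage13HParams F 2) (hP : θ.Provisos₁₃CoPHAx F 2) (g₀ : ℕ → ℝ) (os : List (ULoop F)),
        N16HolderAt (rrOfRecord 𝔯' ksel F θ hP g₀ os).ne3 β) ∧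
      eraseNE3Ax 𝔯' = eraseNE3Ax 𝔯 := by
  obtain ⟨ℓ₃, g, B, hend, hmatch, hrow⟩ := hW
  refine ⟨repinAx 𝔯 ℓ₃ B, ℓ₃, g, B, ⟨guardedReading_repinAx h ℓ₃ B, ?_, hend, hmatch⟩, fun F θ hP g₀ os => ?_, eraseNE3Cmap_repinCmap 𝔯 ℓ₃ B⟩
  · exact Summit.QuantumFields.YangMills.BalabanUVNodes.N16WitnessDialFaceCmap.n16PinnedLooseCmap_repin 𝔯 ℓ₃ B
  · exact Summit.QuantumFields.YangMills.BalabanUVNodes.N16EntrySqueezeJunctionReadingFree.n16HolderAt_rateCarriersAx_of_looseLayer hrow _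
      (Summit.QuantumFields.YangMills.BalabanUVNodes.N16WitnessDialFaceCmap.n16PinnedLooseCmap_repin 𝔯 ℓ₃ B) F θ hP g₀ os _

/-! ## §3 The K4 face splits along node N16: the NE3-erased face and node N16's rows -/

section Split

variable {𝔯 : RateReading13AxP} {ksel : RunSel}

/-- One bundle: `PHolderD4` at the erased reading's bundle + node N16's conjunct at `𝔯`'s bundle ⟹ `PHolderD4` at `𝔯`'s bundle (R12's erased-rates `Iff`; the read-out and the
`ρ`-letter read `u3`, which the erasure does not touch). [bookkeeping] -/
theorem pHolderD4_of_eraseNE3 {F : T4Family} {θ : Stage13HParams F 2} (hP : θ.Provisos₁₃CoPHAx F 2) (g₀ : ℕ → ℝ) (os : List (ULoop F)) (k : ℕ)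
    (D : Datum F 2) (h : PHolderD4 β D (rateCarriersOfRecord₁₃CoPHCmap (eraseNE3Ax 𝔯) F θ hP g₀ os k))
    (h16 : N16HolderAt (rateCarriersOfRecord₁₃CoPHCmap 𝔯 F θ hP g₀ os k).ne3 β) :
    PHolderD4 β D (rateCarriersOfRecord₁₃CoPHCmap 𝔯 F θ hP g₀ os k) := by
  obtain ⟨hR, hRO, hρ⟩ := h
  obtain ⟨h14, h15, h17, h18, h22⟩ := (ratesHolderAt_rateCarriersCmap_eraseNE3_iff 𝔯 θ hP g₀ os k D β).1 hR
  exact ⟨⟨h14, h15, h16, h17, h18, h22⟩, hRO, hρ⟩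

/-- … and conversely the erased bundle's `PHolderD4` from `𝔯`'s (node N16's conjunct dropped). [bookkeeping] -/
theorem pHolderD4_eraseNE3 {F : T4Family} {θ : Stage13HParams F 2} (hP : θ.Provisos₁₃CoPHAx F 2) (g₀ : ℕ → ℝ) (os : List (ULoop F)) (k : ℕ)
    (D : Datum F 2) (h : PHolderD4 β D (rateCarriersOfRecord₁₃CoPHCmap 𝔯 F θ hP g₀ os k)) :
    PHolderD4 β D (rateCarriersOfRecord₁₃CoPHCmap (eraseNE3Ax 𝔯) F θ hP g₀ os k) := by
  obtain ⟨⟨h14, h15, -, h17, h18, h22⟩, hRO, hρ⟩ := h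
  exact ⟨(ratesHolderAt_rateCarriersCmap_eraseNE3_iff 𝔯 θ hP g₀ os k D β).2 ⟨h14, h15, h17, h18, h22⟩, hRO, hρ⟩

/-- **THE K4 FACE AT `𝔯` GIVES THE K4 FACE AT THE NE3-ERASED READING** (node N16's conjunct dropped under `ForSmallCouplings.mono`) — so the bill's erased-face hypothesis is
NECESSARY for the stub-1 text. [bookkeeping] -/
theorem keyedRatesHolderD4V_eraseNE3 (hK : KeyedRatesHolderD4V β (rrOfRecord 𝔯 ksel)) : KeyedRatesHolderD4V β (rrOfRecord (eraseNE3Ax 𝔯) ksel) :=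
  fun F θ hP v hG hθ hB hE => (hK F θ hP v hG hθ hB hE).mono fun g₀ hall os => pHolderD4_eraseNE3 hP.toCore g₀ os _ _ (hall os)

/-- **THE K4 FACE AT THE NE3-ERASED READING + NODE N16's CONJUNCT AT EVERY TUPLE GIVE THE K4 FACE AT `𝔯`** (`ForSmallCouplings.mono`). [bookkeeping] -/
theorem keyedRatesHolderD4V_of_eraseNE3 (hK : KeyedRatesHolderD4V β (rrOfRecord (eraseNE3Ax 𝔯) ksel))
    (h16 : ∀ (F : T4Family) (θ : Stage13HParams F 2) (hP : θ.Provisos₁₃CoPHAx F 2) (g₀ : ℕ → ℝ) (os : List (ULoop F)),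
      N16HolderAt (rrOfRecord 𝔯 ksel F θ hP g₀ os).ne3 β) :
    KeyedRatesHolderD4V β (rrOfRecord 𝔯 ksel) :=
  fun F θ hP v hG hθ hB hE => (hK F θ hP v hG hθ hB hE).mono fun g₀ hall os => pHolderD4_of_eraseNE3 hP.toCore g₀ os _ _ (hall os) (h16 F θ hP.toCore g₀ os)

end Split

/-! ## §4 ★★ The stub-1 bill with node N16 paid -/

/-- **★★ THE REGISTERED STUB-1 TEXT FROM: β IN PRINT's WINDOW, ONE v4-GUARDED READING, THE K4 FACE AT ITS NE3-ERASED READING, AND NODE N16's READING-FREE WITNESS SENTENCE.**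
The conclusion is `K3Skeleton13SepCoPHAxV8.stub_rates13HV`'s type spelled in the mirror's names (= `K3AxV8StubTexts.Stub1TextV8` by `Iff.rfl`); the witness reading is
`repinAx 𝔯 ℓ₃ B`, which IS `𝔯` off the NE3 layer, so the erased face transfers verbatim (§2's equation).  NOT a proof of the stub: (ii) the guarded reading and (iii) the erased
face are the OTHER lanes' (N14 ∕ N15 ∕ N17 ∕ N18 ∕ N22 ∕ node U3 ∕ the β-road's), (iv) is node N16's modulo its displayed in-edges. [bookkeeping] -/
theorem stub1Text_of_witnessFree (hβ : 2 / 3 < β ∧ β < 1) (hW : WitnessDialN16Free 2 β) {𝔯 : RateReading13AxP} {ksel : RunSel} {ℓ : LetterReading}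
    (hG : GuardedReading 𝔯 ksel ℓ) (hK : KeyedRatesHolderD4V β (rrOfRecord (eraseNE3Ax 𝔯) ksel)) :
    ∃ β : ℝ, 2 / 3 < β ∧ β < 1 ∧
      ∃ (𝔯 : RateReading13AxP) (ksel : RunSel) (ℓ : LetterReading) (ℓ₃ : T4Family → Node00.NE3Letters₁₁) (g B : T4Family → ℝ),
        GuardedReadingN16 𝔯 ksel ℓ ℓ₃ g B ∧ KeyedRatesHolderD4V β (rrOfRecord 𝔯 ksel) := by
  obtain ⟨𝔯', ℓ₃, g, B, hGN, h16, hers⟩ := exists_guardedReadingN16_of_witnessFree hW hG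
  refine ⟨β, hβ.1, hβ.2, 𝔯', ksel, ℓ, ℓ₃, g, B, hGN, keyedRatesHolderD4V_of_eraseNE3 ?_ h16⟩
  rw [hers]
  exact hK

/-- **★★ THE BILL FROM NODE N16's CHAIN-ENTRY OBJECT AND THE SLOT KEY** (`β ≤ 1` is implied by the window; hE + `G hGm hG C hR` displayed — module 63 §1's producer ∘ §4).
[cite: Balaban1985Variational, Thm 1 (9)–(10) p.279] [folklore] -/
theorem stub1Text_of_entry_reg910Slot (hβ : 2 / 3 < β ∧ β < 1)
    (hE : ∀ F : T4Family, ∃ B Bh c₁' : ℝ, 0 < B ∧ 0 < c₁' ∧ 16 * (B * c₁') ≤ 1 ∧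
      ∀ k, 1 ≤ k → Thm4TorusAt F.L k (((ne3NperOfRecord₁₁ F 0 0 * F.L ^ k : ℕ) : ℤ)) (((F.L : ℝ) ^ k)⁻¹) c₁' (unitaryUnits (Matrix (Fin 2) (Fin 2) ℂ))
        (fun _ => True) (Restr129 F.L k (torusLam k))
        (fun (α₀ α₁ : ℝ) (U₀ U' : Site 4 → Fin 4 → (Matrix (Fin 2) (Fin 2) ℂ)ˣ) (u : Site 4 → (Matrix (Fin 2) (Fin 2) ℂ)ˣ) =>
          ∃ A : Site 4 → Fin 4 → Matrix (Fin 2) (Fin 2) ℂ,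
            (∀ x μ, IsSelfAdjoint (A x μ)) ∧ (∀ (x : Site 4) (κ μ : Fin 4), A (x + (((ne3NperOfRecord₁₁ F 0 0 * F.L ^ k : ℕ) : ℤ)) • e κ) μ = A x μ) ∧
            mgauge U₀ u (cfgExp (((F.L : ℝ) ^ k)⁻¹) A) = U' ∧
            (∀ x μ, ‖A x μ‖ ≤ B * (α₀ + α₁)) ∧
            (∀ (μ : Fin 4) (x : Site 4) (κ : Fin 4), ‖covDerivFwd (((F.L : ℝ) ^ k)⁻¹) U₀ μ (fun z => A z κ) x‖ ≤ B * (α₀ + α₁)) ∧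
            IsLandau138 F.L k (((F.L : ℝ) ^ k)⁻¹) Set.univ (torusLam k) U₀ A ∧
            (∀ (μ : Fin 4) (y : Site 4) (κ : Fin 4),
              ‖Ad (U₀ y μ) (covDerivFwd (((F.L : ℝ) ^ k)⁻¹) U₀ μ (fun z => A z κ) (y + e μ)) - covDerivFwd (((F.L : ℝ) ^ k)⁻¹) U₀ μ (fun z => A z κ) y‖
                ≤ Bh * (α₀ + α₁) * (((F.L : ℝ)⁻¹) ^ k) ^ β) ∧
            (∀ (x : Site 4) (κ : Fin 4), ‖covLap (((F.L : ℝ) ^ k)⁻¹) U₀ (fun z => A z κ) x‖ ≤ B * (α₀ + α₁))))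
    {G : T4Family → (Site 4 → Fin 4 → (MatA 2)ˣ) → Site 4 → ℕ → ℝ → ℝ → ℝ → Prop} (hGm : ∀ F, RadiiMono 4 (G F))
    (hG : ∀ (F : T4Family) (U : Site 4 → Fin 4 → (MatA 2)ˣ) (x : Site 4) (K : ℕ) (α₀ α₁ α₂ : ℝ), 2 ≤ K → G F U x K α₀ α₁ α₂ →
      ∃ (u : Site 4 → (MatA 2)ˣ) (a : Site 4 → Fin 4 → MatA 2),
        (∀ z, u z ∈ unitaryUnits (MatA 2)) ∧
        (∀ (y : Site 4) (τ : Fin 4), l1 (y - x) ≤ 2 → ((gaugeAct u U y τ : (MatA 2)ˣ) : MatA 2) = exp (a y τ)) ∧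
        (∀ (y : Site 4) (τ : Fin 4), l1 (y - x) ≤ 2 → ‖a y τ‖ ≤ α₀) ∧
        (∀ (y : Site 4) (τ i : Fin 4), l1 (y - x) ≤ 1 → ‖fd i (fun z => a z τ) y‖ ≤ α₁) ∧
        (∀ (τ i l : Fin 4), ‖fd i (fd l (fun z => a z τ)) x‖ ≤ α₂))
    (C : T4Family → B11Thm1.Consts)
    (hR : ∀ (F : T4Family) (k : ℕ) (ε₁ : ℝ), 0 < ε₁ → ε₁ ≤ (C F).a₁ → ∀ (V U : Site 4 → Fin 4 → (MatA 2)ˣ), V ∈ sfClass 4 F.L (ne3NperOfRecord₁₁ F 0 0) ε₁ 0 →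
      IsMinimiser 4 (sfClass 4 F.L (ne3NperOfRecord₁₁ F 0 0) ((C F).B₃ * ε₁)) F.L (ne3NperOfRecord₁₁ F 0 0) (k + 1) V U →
        ∀ x : Site 4, Regularity (torusVP 4 F.L (ne3NperOfRecord₁₁ F 0 0) (G F) (k + 1)) (C F).B₃ (C F).B₄ ε₁ U (x, F.L ^ (k + 1) - 1 + F.L ^ (k + 1) + 2))
    {𝔯 : RateReading13AxP} {ksel : RunSel} {ℓ : LetterReading} (hGd : GuardedReading 𝔯 ksel ℓ) (hK : KeyedRatesHolderD4V β (rrOfRecord (eraseNE3Ax 𝔯) ksel)) :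
    ∃ β : ℝ, 2 / 3 < β ∧ β < 1 ∧
      ∃ (𝔯 : RateReading13AxP) (ksel : RunSel) (ℓ : LetterReading) (ℓ₃ : T4Family → Node00.NE3Letters₁₁) (g B : T4Family → ℝ),
        GuardedReadingN16 𝔯 ksel ℓ ℓ₃ g B ∧ KeyedRatesHolderD4V β (rrOfRecord 𝔯 ksel) :=
  stub1Text_of_witnessFree hβ (witnessDialN16Free_of_entry_reg910Slot hβ.2.le hE hGm hG C hR) hGd hK

/-- **★★ THE BILL FROM NODE N05's Σ-OBJECT AND THE SLOT KEY** (`0 ≤ β` from the window; `hN05` = p681888's conclusion text at `stage3OfFamilyMat F 2` and `G hGm hG C hR`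
displayed — module 63 §1's `witnessDialN16Free_of_n05UniformP_reg910Slot` ∘ §4's bill).  v1.1 EDITION (append-only; referee ref-K READ-698 NIT N1: the hN05 form announced in
the header). [cite: Balaban1985RegularSpaces, Thm 4 p.88, Prop. 3 p.87] [folklore] -/
theorem stub1Text_of_n05UniformP_reg910Slot (hβ : 2 / 3 < β ∧ β < 1)
    (hN05 : ∀ F : T4Family, letI : CStarAlgebra (Matrix (Fin 2) (Fin 2) ℂ) := B10Eq29TubeLine.cstarAlgebraMatrix 2
      ∃ (Mκ Rκ : ℕ) (len : Site 4 → ℝ), (∀ v : Site 4, 0 < len v → 1 ≤ len v) ∧ (∀ μ : Fin 4, len (e μ) = 1) ∧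
      ∃ (inp : B8.B9Inputs) (B₀β B₈ c₄ c₃ : ℝ), inp.B₀ ≤ B₈ ∧ 0 < c₄ ∧ 0 < c₃ ∧
        ∀ (ν : {k : ℕ // 1 ≤ k}) (a : IdxB8SubDPerκ (stage3OfFamilyMat F 2) (ne3NperOfRecord₁₁ F 0 0 * F.L ^ ν.1) Mκ Rκ),
          B8.Thm4Body c₄ (5 * ((4 : ℕ) : ℝ) * F.L * B₈)
            (fun _ : Unit => (zdGF3HP₂Per (Matrix (Fin 2) (Fin 2) ℂ) F.L β len a.toZdIdx (ne3NperOfRecord₁₁ F 0 0 * F.L ^ ν.1)).toGFData) ∧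
          B8.Prop3Body c₃ 4 (F.L : ℝ) (2097152 * (((4 : ℕ) : ℝ) + 1) ^ 2 * (F.L : ℝ) ^ 2) inp B₀β
            (fun _ : Unit => (zdGF3HP₂Per (Matrix (Fin 2) (Fin 2) ℂ) F.L β len a.toZdIdx (ne3NperOfRecord₁₁ F 0 0 * F.L ^ ν.1)).toGFData2))
    {G : T4Family → (Site 4 → Fin 4 → (MatA 2)ˣ) → Site 4 → ℕ → ℝ → ℝ → ℝ → Prop} (hGm : ∀ F, RadiiMono 4 (G F))
    (hG : ∀ (F : T4Family) (U : Site 4 → Fin 4 → (MatA 2)ˣ) (x : Site 4) (K : ℕ) (α₀ α₁ α₂ : ℝ), 2 ≤ K → G F U x K α₀ α₁ α₂ →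
      ∃ (u : Site 4 → (MatA 2)ˣ) (a : Site 4 → Fin 4 → MatA 2),
        (∀ z, u z ∈ unitaryUnits (MatA 2)) ∧
        (∀ (y : Site 4) (τ : Fin 4), l1 (y - x) ≤ 2 → ((gaugeAct u U y τ : (MatA 2)ˣ) : MatA 2) = exp (a y τ)) ∧
        (∀ (y : Site 4) (τ : Fin 4), l1 (y - x) ≤ 2 → ‖a y τ‖ ≤ α₀) ∧
        (∀ (y : Site 4) (τ i : Fin 4), l1 (y - x) ≤ 1 → ‖fd i (fun z => a z τ) y‖ ≤ α₁) ∧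
        (∀ (τ i l : Fin 4), ‖fd i (fd l (fun z => a z τ)) x‖ ≤ α₂))
    (C : T4Family → B11Thm1.Consts)
    (hR : ∀ (F : T4Family) (k : ℕ) (ε₁ : ℝ), 0 < ε₁ → ε₁ ≤ (C F).a₁ → ∀ (V U : Site 4 → Fin 4 → (MatA 2)ˣ), V ∈ sfClass 4 F.L (ne3NperOfRecord₁₁ F 0 0) ε₁ 0 →
      IsMinimiser 4 (sfClass 4 F.L (ne3NperOfRecord₁₁ F 0 0) ((C F).B₃ * ε₁)) F.L (ne3NperOfRecord₁₁ F 0 0) (k + 1) V U →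
        ∀ x : Site 4, Regularity (torusVP 4 F.L (ne3NperOfRecord₁₁ F 0 0) (G F) (k + 1)) (C F).B₃ (C F).B₄ ε₁ U (x, F.L ^ (k + 1) - 1 + F.L ^ (k + 1) + 2))
    {𝔯 : RateReading13AxP} {ksel : RunSel} {ℓ : LetterReading} (hGd : GuardedReading 𝔯 ksel ℓ) (hK : KeyedRatesHolderD4V β (rrOfRecord (eraseNE3Ax 𝔯) ksel)) :
    ∃ β : ℝ, 2 / 3 < β ∧ β < 1 ∧
      ∃ (𝔯 : RateReading13AxP) (ksel : RunSel) (ℓ : LetterReading) (ℓ₃ : T4Family → Node00.NE3Letters₁₁) (g B : T4Family → ℝ),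
        GuardedReadingN16 𝔯 ksel ℓ ℓ₃ g B ∧ KeyedRatesHolderD4V β (rrOfRecord 𝔯 ksel) :=
  stub1Text_of_witnessFree hβ
    (witnessDialN16Free_of_n05UniformP_reg910Slot (le_trans (by norm_num) hβ.1.le) hβ.2.le hN05 hGm hG C hR) hGd hK

end

end Summit.QuantumFields.YangMills.BalabanUVNodes.N16Stub1ShareK3AxV8
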